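import Literature.MathematicalPhysics.QuantumFieldTheory.Balaban1983to89.B9Eq369CurvSmallZd
import Literature.MathematicalPhysics.QuantumFieldTheory.Balaban1983to89.B9SupplySockB9P3ZdGammaInAk

/-!
# `Balaban1983to89.B9SupplySockB9P3ZdGammaInAkDpZd` — THE GENUINE CURVATURE LETTER `Δ′(U₀)` OF [Balaban1985BackgroundPropagators] (3.10)
# PLUGGED INTO THE J-N06→N05 JUNCTION'S LETTER RECORD: `withDpZd ops` (the record with its `Dp` field REPLACED by `B9Eq369CurvSmallZd.DpZd`)
# DISCHARGES dag-n06-b's binder `CurvAtInAk` (edition γ·InAk, (3.69) in B8's (1.7)-currency) BY NAME at every member with `M ≥ 1`,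
# constant `c69 = 14(d−1)`; the binders that do not read `Dp` transfer verbatim; the operator-norm form `|Δ′(U₀)A|₍₋₃₎ ≤ 14(d−1)·α₀·|A|₍₋₁₎`

statement-level skeleton of published theorems with citation tags; proofs where landed; nothing here is a claim about the
Yang–Mills mass gap

PDF held: `paper:balaban1985-cmp99-background-propagators` ([4] = B9; journal page = PDF page + 388), p. 392 (3.10), p. 404 (3.69);
`paper:balaban1985-cmp99-regular-spaces-gauge-fixing` (B8; journal page = PDF page + 74), p. 77 (1.7), p. 86 (1.55)–(1.59).  Displays quoted
verbatim in `B9Eq369Small` ∕ `B9Eq369CurvSmallZd` ((3.10), (3.69)) and `B8Ineq132` ((1.7)), imported BY NAME.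

WHY THIS FILE (cell `pub-ymgap`, HUMAN RULING D-0062 ∕ D-0149; seat `pub-ymgap-dag-n06-w2` (g0), node N06 = [B9]; count-neutral; INTENT-2 of the
seat, hosted here on the binder owner's word «the discharge belongs with the letter's author»).  `B9Eq369CurvSmallZd` (p584031) made the second
letter of `B9SupplySockB9P3ZdLetters.OpsZd` an OBJECT (`DpZd η U₀ A = Δ′(U₀)A` on `ℤᵈ × 𝔸`) and proved print's (3.69) for it in B8's
`𝔄_m({Ω_j}, α₀)`-currency (`curvSmall_inAk_of_Dp_eq(_M)`); dag-n06-b's edition γ·InAk (`B9SupplySockB9P3ZdGammaInAk`) re-typed the junction's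
Δ′-binder into that currency (`CurvAtInAk L ops c69 M i m`) and re-derived the member suppliers (`sockB9P3D4γI_at`, …) on it.  This file is the
one-line junction of the two: for ANY letter family `ops` the record `withDpZd ops` — same `Gop`, `DRDs`, `QQ`, GENUINE `Dp` — satisfies
`CurvAtInAk L (withDpZd ops) (14(d−1)) M i m` outright (`1 ≤ L`, `1 ≤ M`), so the suppliers' `hcurv` hypothesis is GONE at the genuine letter.

WHAT IS DECLARED ∕ PROVED (0 sorry; ONE `def`).
* §1 `withDpZd ops` (def: `fun M i m => { ops M i m with Dp := DpZd i.η }`, dag-n06-b's typing hint); `withDpZd_Dp ∕ _Gop ∕ _DRDs ∕ _QQ` (rfl);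
  `deltaAOf_withDpZd` — `Δ_a(U₀)A` of the new record is `D*_{U₀}D_{U₀}A + Δ′(U₀)A + (ops).DRDs U₀ A + (ops).QQ U₀ A` with the GENUINE middle term
  (the flag for every binder that reads `deltaAOf`: `InvAt` ∕ `SrcAt` now ask G(U₀) to invert the genuine Δ′ — as print's (3.26)–(3.27) do).
* §2 ★★ `curvAtInAk_of_Dp_eq` (any `ops` with `(ops M i m).Dp = DpZd i.η`), ★★ `curvAtInAk_withDpZd` — `CurvAtInAk L (withDpZd ops) (14·(d−1)) M i m`
  for `1 ≤ L`, `1 ≤ M` (feeds `sockB9P3D4γI_at` ∕ `sockB9P3PI_at_univ` at `c69 := 14(d−1)`).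
* §3 transfers for the binders that do NOT read `Dp` (definitional, `Iff.rfl`): `landauAt_withDpZd_iff`, `avgAtγ_withDpZd_iff`, `holderAt_withDpZd_iff`,
  `gopAddAt_withDpZd_iff`, `dictAt_withDpZd_iff`.
* §4 ★ `bondNorm_DpZd_le_of_inAk` — THE OPERATOR-NORM FORM OF (3.69) in B8's weighted currency ([4] p. 392 «a bounded, small operator»; the (Q3)
  shape `|Δ′A′|₍₋₃₎ ≤ κ|A′|₍₋₁₎` of `B8FromB9`): `bondNorm L m η (−3) Ω (Δ′(U₀)A) ≤ 14(d−1)·α₀·|A|₍₋₁₎` (`|A|₍₋₁₎` over the sides of the plaquettes of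
  the `Ω_j`) for `U₀ ∈ 𝔄_m({Ω_j}, α₀)` unitary and a bounded family `A`.
* §5 `DpZd_gaugeAct` — the gauge covariance (3.30) of the genuine letter, `Δ′(U₀^u)(R(u)A) = R(u)(Δ′(U₀)A)` (pv27's `deltaPrimeOp_gaugeTr` transported).

HONEST SCOPE.  Bookkeeping over p584031 and edition γ·InAk; no estimate beyond p584031's (3.69); the other three letters stay parameters (so `InvAt`,
`LandauAt`, `AvgAt*`, `HolderAt`, `SrcAt` remain hypotheses of the suppliers — about `Gop`, `DRDs`, `QQ` and, through `deltaAOf`, the genuine Δ′);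
count-neutral; N05 ∕ N06 NOT discharged; one finite lattice programme at fixed `ε`; R4 closes the conditional finite-𝕋⁴ rung `BalabanLadder.UV` only;
nothing continuum ∕ ℝ⁴ ∕ OS ∕ mass-gap ∕ Clay.  Unit `pub-ymgap-dag-n06-w2` (g0), 2026-08-27.
-/

noncomputable section

namespace Literature.MathematicalPhysics.QuantumFieldTheory.Balaban1983to89.B9SupplySockB9P3ZdGammaInAkDpZd

open B7Prop2Explicit (unitaryUnits)
open B8Ineq132 (BondTouches InAk)
open B8Eq140Level (SideTouches sideTouches_of_bondTouches)
open B8Eq155JBound (Jcur)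
open B8ScaledSupNorm (msup Bdd bondNorm msup_le msup_nonneg)
open B8LeafModelZd (ZdIdx)
open B9SupplySockB9P3ZdLetters (OpsZd deltaAOf)
open B9SupplySockB9P3ZdLettersOmega (OnDom)
open B9SupplySockB9P3ZdAt (LandauAt HolderAt GopAddAt DictAt)
open B9SupplySockB9P3ZdGamma (AvgAtγ)
open B9SupplySockB9P3ZdGammaInAk (CurvAtInAk)
open B9Eq369CurvSmallZd (DpZd curvSmall_inAk_of_Dp_eq_M scale3_norm_DpZd_le_msup_of_inAk)

-- `Site` alone could resolve to the torus sites of `Setup.lean`; re-export the `ℤ^d` sites of `B7Prop1Explicit`.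
export B7Prop1Explicit (Site)

variable {d : ℕ} {𝔸 : Type*} [CStarAlgebra 𝔸] {L : ℕ}

/-! ## §1 The letter record with the genuine `Δ′` -/

/-- **THE LETTER RECORD WITH THE GENUINE CURVATURE LETTER**: `ops` with its field `Dp` replaced, at every member `(M, i, m)`, by `Δ′(U₀)` of (3.10) on
`ℤᵈ` at the member's lattice spacing `i.η` (`B9Eq369CurvSmallZd.DpZd`); `Gop`, `DRDs`, `QQ` untouched.
[cite: Balaban1985BackgroundPropagators, (3.10) p.392, (3.26) p.395] -/
def withDpZd (ops : ℝ → ZdIdx d L → ℕ → OpsZd d 𝔸) : ℝ → ZdIdx d L → ℕ → OpsZd d 𝔸 :=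
  fun M i m => { ops M i m with Dp := DpZd i.η }

/-- the `Dp` field of `withDpZd ops` is the genuine `Δ′`. [cite: Balaban1985BackgroundPropagators, (3.10) p.392] -/
theorem withDpZd_Dp (ops : ℝ → ZdIdx d L → ℕ → OpsZd d 𝔸) (M : ℝ) (i : ZdIdx d L) (m : ℕ) :
    (withDpZd ops M i m).Dp = DpZd i.η := rfl

/-- the `Gop` field is untouched. [cite: Balaban1985BackgroundPropagators, (3.27) p.395] -/
theorem withDpZd_Gop (ops : ℝ → ZdIdx d L → ℕ → OpsZd d 𝔸) (M : ℝ) (i : ZdIdx d L) (m : ℕ) :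
    (withDpZd ops M i m).Gop = (ops M i m).Gop := rfl

/-- the `DRDs` field is untouched. [cite: Balaban1985BackgroundPropagators, (3.20)–(3.26) pp.394–395] -/
theorem withDpZd_DRDs (ops : ℝ → ZdIdx d L → ℕ → OpsZd d 𝔸) (M : ℝ) (i : ZdIdx d L) (m : ℕ) :
    (withDpZd ops M i m).DRDs = (ops M i m).DRDs := rfl

/-- the `QQ` field is untouched. [cite: Balaban1985BackgroundPropagators, (3.16) p.393] -/
theorem withDpZd_QQ (ops : ℝ → ZdIdx d L → ℕ → OpsZd d 𝔸) (M : ℝ) (i : ZdIdx d L) (m : ℕ) :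
    (withDpZd ops M i m).QQ = (ops M i m).QQ := rfl

/-- **`Δ_a(U₀)` OF THE NEW RECORD CARRIES THE GENUINE `Δ′`**: `Δ_a(U₀)A = D*_{U₀}D_{U₀}A + Δ′(U₀)A + DR(U₀)D*A + Q*aQ A` ((3.26) with (3.10)) with the
middle term an object — so every binder reading `deltaAOf` (`InvAt`, `SrcAt`) now speaks of the genuine Δ′. [cite: Balaban1985BackgroundPropagators, (3.26) p.395, (3.10) p.392] -/
theorem deltaAOf_withDpZd (ops : ℝ → ZdIdx d L → ℕ → OpsZd d 𝔸) (M : ℝ) (i : ZdIdx d L) (m : ℕ) (U₀ : Site d → Fin d → 𝔸ˣ)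
    (A : Site d → Fin d → 𝔸) (x : Site d) (μ : Fin d) :
    deltaAOf i.η (withDpZd ops M i m) U₀ A x μ =
      Jcur i.η U₀ A μ x + DpZd i.η U₀ A x μ + (ops M i m).DRDs U₀ A x μ + (ops M i m).QQ U₀ A x μ := rfl

/-! ## §2 The Δ′-binder of edition γ·InAk holds for the genuine letter -/

variable [Nontrivial 𝔸]

/-- ★★ **`CurvAtInAk` FOR EVERY LETTER RECORD WHOSE `Dp` IS THE GENUINE `Δ′`** (`1 ≤ L`, `1 ≤ M`; constant `14(d−1)`): dag-n06-b's binder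
`B9SupplySockB9P3ZdGammaInAk.CurvAtInAk` by `B9Eq369CurvSmallZd.curvSmall_inAk_of_Dp_eq_M`.
[cite: Balaban1985BackgroundPropagators, (3.69) p.404, (3.41) p.397; Balaban1985RegularSpaces, (1.7) p.77, (1.59) p.86] -/
theorem curvAtInAk_of_Dp_eq (hL : 1 ≤ L) {ops : ℝ → ZdIdx d L → ℕ → OpsZd d 𝔸}
    (hDp : ∀ (M : ℝ) (i : ZdIdx d L) (m : ℕ), (ops M i m).Dp = DpZd i.η) {M : ℝ} (hM : 1 ≤ M) (i : ZdIdx d L) (m : ℕ) :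
    CurvAtInAk L ops (14 * ((d - 1 : ℕ) : ℝ)) M i m :=
  fun _ U₀ hU₀ hα hA A hOn _ hj x μ hb => curvSmall_inAk_of_Dp_eq_M hL hDp hM i m hα.le U₀ hU₀ hA A hOn hj x μ hb

/-- ★★ **`CurvAtInAk L (withDpZd ops) (14·(d−1)) M i m`** — the suppliers' `hcurv` hypothesis (`sockB9P3D4γI_at`, `sockB9P3PI_at_univ`) DISCHARGED at
the record carrying the genuine `Δ′`, for every `ops`, `1 ≤ L`, `1 ≤ M`. [cite: Balaban1985BackgroundPropagators, (3.69) p.404; Balaban1985RegularSpaces, (1.7) p.77, (1.59) p.86] -/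
theorem curvAtInAk_withDpZd (hL : 1 ≤ L) (ops : ℝ → ZdIdx d L → ℕ → OpsZd d 𝔸) {M : ℝ} (hM : 1 ≤ M) (i : ZdIdx d L) (m : ℕ) :
    CurvAtInAk L (withDpZd ops) (14 * ((d - 1 : ℕ) : ℝ)) M i m :=
  curvAtInAk_of_Dp_eq hL (withDpZd_Dp ops) hM i m

/-! ## §3 The binders that do not read `Dp` transfer verbatim -/

section Transfer

omit [Nontrivial 𝔸]

variable {I : Type} (geo : I → B9.Geometry) (bg : I → B9.Backgrounds) (GA : ∀ i, B9.KernelFamily (geo i) (bg i))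
variable (mem : ℝ → ZdIdx d L → ℕ → I)
variable (ιCfg : ∀ (M : ℝ) (i : ZdIdx d L) (m : ℕ) (U₀ : Site d → Fin d → 𝔸ˣ),
  (∀ x κ, U₀ x κ ∈ unitaryUnits 𝔸) → (bg (mem M i m)).Cfg)
variable (ιLoc : ∀ (M : ℝ) (i : ZdIdx d L) (m : ℕ), (Site d → Fin d → 𝔸) → (geo (mem M i m)).Loc)

/-- `LandauAt` reads `DRDs` only: unchanged under `withDpZd`. [cite: Balaban1985BackgroundPropagators, (3.20)–(3.21) p.394] -/
theorem landauAt_withDpZd_iff (ops : ℝ → ZdIdx d L → ℕ → OpsZd d 𝔸) (c35 a₃ M : ℝ) (i : ZdIdx d L) (m : ℕ) :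
    LandauAt bg L mem ιCfg (withDpZd ops) c35 a₃ M i m ↔ LandauAt bg L mem ιCfg ops c35 a₃ M i m := Iff.rfl

/-- `AvgAtγ` reads `QQ` only: unchanged under `withDpZd`. [cite: Balaban1985BackgroundPropagators, (3.16) p.393; Balaban1985RegularSpaces, (1.56) p.86] -/
theorem avgAtγ_withDpZd_iff (ops : ℝ → ZdIdx d L → ℕ → OpsZd d 𝔸) (q : ℝ) (ΛbP : ℕ → ℕ → Set (Site d × Fin d)) (M : ℝ)
    (i : ZdIdx d L) (m : ℕ) : AvgAtγ L (withDpZd ops) q ΛbP M i m ↔ AvgAtγ L ops q ΛbP M i m := Iff.rfl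

/-- `HolderAt` reads `Gop` only: unchanged under `withDpZd`. [cite: Balaban1985BackgroundPropagators, (3.43) p.398; Balaban1985RegularSpaces, Prop. 3 p.87] -/
theorem holderAt_withDpZd_iff (ops : ℝ → ZdIdx d L → ℕ → OpsZd d 𝔸) (β : ℝ) (len : Site d → ℝ) (CH M : ℝ) (i : ZdIdx d L) (m : ℕ) :
    HolderAt geo bg GA L mem ιCfg (withDpZd ops) β len CH M i m ↔ HolderAt geo bg GA L mem ιCfg ops β len CH M i m := Iff.rfl

/-- `GopAddAt` reads `Gop` only: unchanged under `withDpZd`. [cite: Balaban1985BackgroundPropagators, (3.27) p.395] -/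
theorem gopAddAt_withDpZd_iff (ops : ℝ → ZdIdx d L → ℕ → OpsZd d 𝔸) (M : ℝ) (i : ZdIdx d L) (m : ℕ) :
    GopAddAt L (withDpZd ops) M i m ↔ GopAddAt L ops M i m := Iff.rfl

/-- `DictAt` reads `Gop` only: unchanged under `withDpZd`. [cite: Balaban1985BackgroundPropagators, (3.47) p.398] -/
theorem dictAt_withDpZd_iff (ops : ℝ → ZdIdx d L → ℕ → OpsZd d 𝔸) (M : ℝ) (i : ZdIdx d L) (m : ℕ) :
    DictAt geo bg GA L mem ιCfg ιLoc (withDpZd ops) M i m ↔ DictAt geo bg GA L mem ιCfg ιLoc ops M i m := Iff.rfl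

end Transfer

/-! ## §4 (3.69) as an operator-norm bound in B8's weighted currency -/

/-- ★ **`|Δ′(U₀)A|₍₋₃₎ ≤ 14(d−1)·α₀·|A|₍₋₁₎`** — [4] p. 392 «the operator Δ′ will be a bounded, small operator» in the weighted norms (3.41) ∕ B8 p. 86
(`B8ScaledSupNorm.bondNorm` at exponent `−3` over the bonds of the `Ω_j`, `j ≤ m`, against `msup` at exponent `−1` over the sides of their plaquettes;
the (Q3) shape of `B8FromB9`), for a unitary `U₀ ∈ 𝔄_m({Ω_j}, α₀)` and a bounded family `A` (`L ≥ 1`, `α₀ ≥ 0`).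
[cite: Balaban1985BackgroundPropagators, (3.69) p.404, (3.41) p.397, p.392; Balaban1985RegularSpaces, (1.7) p.77, p.86] -/
theorem bondNorm_DpZd_le_of_inAk (hL : 1 ≤ L) {m : ℕ} {η : ℝ} (hη : 0 < η) {U₀ : Site d → Fin d → 𝔸ˣ}
    (hU₀ : ∀ x κ, U₀ x κ ∈ unitaryUnits 𝔸) {Ω : ℕ → Set (Site d)} {α₀ : ℝ} (hα₀ : 0 ≤ α₀) (hreg : InAk L m η α₀ Ω U₀)
    {A : Site d → Fin d → 𝔸} (hB : Bdd L m η (-(1 : ℝ)) (fun j (b : Site d × Fin d) => SideTouches (Ω j) b.1 b.2) (fun b => A b.1 b.2)) :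
    bondNorm L m η (-(3 : ℝ)) Ω (DpZd η U₀ A) ≤
      (14 * ((d - 1 : ℕ) : ℝ)) * α₀ * msup L m η (-(1 : ℝ)) (fun j (b : Site d × Fin d) => SideTouches (Ω j) b.1 b.2) (fun b => A b.1 b.2) := by
  have hN := msup_nonneg L m hη.le (-(1 : ℝ)) (fun j (b : Site d × Fin d) => SideTouches (Ω j) b.1 b.2) (fun b => A b.1 b.2)
  refine msup_le (by positivity) fun j hj b hb => ?_
  have hw : B8ScaledSupNorm.weight L η (-(3 : ℝ)) j = ((L : ℝ) ^ j * η) ^ 3 := by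
    simpa using B8ScaledSupNorm.weight_neg_natCast L η 3 j
  rw [hw]
  exact scale3_norm_DpZd_le_msup_of_inAk hL hη hU₀ hreg hj hB hb

/-! ## §5 Gauge covariance of the genuine letter -/

omit [Nontrivial 𝔸] in
/-- **`Δ′(U₀^u)(R(u)A) = R(u)(Δ′(U₀)A)`** — the gauge covariance (3.30) of the genuine letter on `ℤᵈ` ([4] p. 398: «All these inequalities are invariant
with respect to gauge transformations of U»): the abstract-lattice covariance `B9Eq3117Current.deltaPrimeOp_gaugeTr` (commuting shifts) transported by
`B8Eq133Hypotheses.gaugeTr_byDir` ([4]'s `U^u` (3.28) = [B8]'s `gaugeAct`). [cite: Balaban1985BackgroundPropagators, (3.28)–(3.30) p.395, p.398] -/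
theorem DpZd_gaugeAct (η : ℝ) (u : Site d → 𝔸ˣ) (U₀ : Site d → Fin d → 𝔸ˣ) (A : Site d → Fin d → 𝔸) (x : Site d) (μ : Fin d) :
    DpZd η (B7Prop1Explicit.gaugeAct u U₀) (fun y τ => B9Eq39Adjoint.R (u y) (A y τ)) x μ =
      B9Eq39Adjoint.R (u x) (DpZd η U₀ A x μ) := by
  have hT : ∀ (κ ν : Fin d) (y : Site d),
      B8Eq133Hypotheses.shiftT d κ (B8Eq133Hypotheses.shiftT d ν y) = B8Eq133Hypotheses.shiftT d ν (B8Eq133Hypotheses.shiftT d κ y) := by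
    intro κ ν y
    simp only [B8Eq133Hypotheses.shiftT_apply, add_right_comm]
  rw [B9Eq369CurvSmallZd.DpZd_apply, B9Eq369CurvSmallZd.DpZd_apply, ← B8Eq133Hypotheses.gaugeTr_byDir]
  exact B9Eq3117Current.deltaPrimeOp_gaugeTr (B8Eq133Hypotheses.shiftT d) (B8Eq133Hypotheses.byDir U₀) hT u η
    (B8Eq133Hypotheses.byDir A) μ x

end Literature.MathematicalPhysics.QuantumFieldTheory.Balaban1983to89.B9SupplySockB9P3ZdGammaInAkDpZd

end
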